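import Mathlib
import HarnessLib

/-!
# Numerical evaluation of the Cauchy principal value (Davis–Rabinowitz 1984, Sect. 2.12.8)

Davis–Rabinowitz, *Methods of Numerical Integration* (2nd ed., 1984), Sect. 2.12.8 "Numerical Evaluation of the
Cauchy Principal Value" (held OCR PDF pp. 147–148). For `f` unbounded near an interior point (w.l.o.g. `c = 0`,
interval `[-a, a]`) whose principal value `P∫ = lim_{r→0+} [∫_{-a}^{-r} f + ∫_r^a f]` exists, THE EVEN/ODD DEVICE:
`g(x) = ½[f(x) - f(-x)]`, `h(x) = ½[f(x) + f(-x)]` **(2.12.8.1)**, `f = g + h` **(2.12.8.2)**, `g` odd **(2.12.8.3)**,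
`h` even **(2.12.8.4)**, hence `∫_{-a}^{-r} f + ∫_r^a f = 2∫_r^a h` **(2.12.8.5)** and
`P∫_{-a}^a f = 2 lim_{r→0+} ∫_r^a h = 2∫_0^a h = ∫_0^a (f(x) + f(-x)) dx` **(2.12.8.6)** ("it is possible that `h`
has no singularity at `x = 0`"); likewise `P∫_{-∞}^{∞} f = 2∫_0^∞ h` **(2.12.8.7)**. EXAMPLES: `P∫_{-1}^1 dx/x = 0`
(`h = 0`); `P∫_{-1}^1 eˣ/x dx = 2∫_0^1 sinh x/x dx` (`h = sinh x/x`, an apparent singularity). SUBTRACTING THE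
SINGULARITY for the Hilbert transform `I(x) = P∫_a^b f(t)/(t-x) dt`, `a < x < b` **(2.12.8.8)**:
`I = ∫_a^b [f(t) - f(x)]/(t - x) dt + f(x) P∫_a^b dt/(t-x) = ∫_a^b φ(t, x) dt + f(x) log[(b-x)/(x-a)]` **(2.12.8.9)**,
`φ(t, x) = [f(t) - f(x)]/(t - x)` **(2.12.8.10)**, and `∫_{x-h}^{x+h} φ(t, x) dt = ∫_{-h}^{h} [f(t+x) - f(x)]/t dt`
**(2.12.8.11)**. PRICE'S RULES for `P∫_{-1}^1 f(x)/x dx`: the nine-point rule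
`A[f(1) - f(-1)] + B[f(¾) - f(-¾)] + C[f(½) - f(-½)] + D[f(¼) - f(-¼)]` **(2.12.8.13)** with
`A = 2459/33075`, `B = 1856/3675`, `C = 592/4725`, `D = 9152/4725` **(2.12.8.14)**, exact for `f ∈ 𝒫_8`; and by (2.12.8.6)
`P∫_{-1}^1 f(x)/x dx = ∫_0^1 [f(x) - f(-x)]/x dx` **(2.12.8.17)**, whence Gauss-type rules.

What is formalised (Mathlib only):

* the objects `cpvOddPart`, `cpvEvenPart` (2.12.8.1), the truncated symmetric integral `cpvTrunc f a r =
  ∫_{-a}^{-r} f + ∫_r^a f`, the difference quotient `cpvPhi` (2.12.8.10) and Price's nine-point rule `priceNinePoint`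
  (2.12.8.13)–(2.12.8.14) with exact rational coefficients;
* PROVED: (2.12.8.2)–(2.12.8.4); the splitting identity (2.12.8.5) (`cpvTrunc_eq_two_mul_integral_evenPart`); the
  device (2.12.8.6) as a limit theorem: if `h` is integrable on `[0, a]` then `cpvTrunc f a r → 2∫_0^a h` as `r → 0+`
  (`tendsto_cpvTrunc_of_evenPart_integrable`); Example 1 (`h = 0` for `1/x`, so every truncation vanishes) and the
  identity `h = sinh x/x` of Example 2; the exact principal value `∫_a^{x-r} dt/(t-x) + ∫_{x+r}^b dt/(t-x) =
  log[(b-x)/(x-a)]` for EVERY `0 < r` small **(the `P∫ dt/(t-x)` of (2.12.8.9))** and the pointwise subtraction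
  identity `f(t)/(t-x) = φ(t,x) + f(x)/(t-x)`; the shift (2.12.8.11); and the exactness of Price's rule (2.12.8.13) on
  the monomials `x^j`, `j ≤ 8` (against `P∫_{-1}^1 x^{j-1} dx`, i.e. `0` for even `j`, `2/j` for odd `j`, and `0` for
  `j = 0` by Example 1).

Not formalised: (2.12.8.7) on `(-∞, ∞)`, the Taylor estimate (2.12.8.12), the Gauss-type rule (2.12.8.15)–(2.12.8.16)
(decimal data) and the general construction following (2.12.8.17).

SIBLINGS IN THE CERTIFICATE LANE (disclosed, not imported): `Literature/Analysis/ValidatedNumerics/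
TaylorModelIntegralCertPrincipalValue.lean` (with `TaylorModelIntegralCertFinitePart.lean`,
`TaylorModelTangentProgram.lean`) cites Sect. 2.12.8 (2.12.8.9)–(2.12.8.12) and (2.12.8.20)–(2.12.8.24): it defines
the principal-value predicate `HasCPV g a b c v` (the truncations `∫_a^{c-ε} g + ∫_{c+ε}^b g → v` as `ε → 0+`) and
certifies Hilbert transforms `P∫ P(t)/(t - c)` of straight-line-program integrands by subtracting the singularity on
a symmetric pole panel (the `log` terms cancelling, `poleQuot_approx`) with Taylor-model enclosures. The present
module records the TEXTBOOK DEVICES of the section over plain real functions — the even/odd splitting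
(2.12.8.1)–(2.12.8.6) (our limit theorem `tendsto_cpvTrunc_of_evenPart_integrable` is, up to `0 - ε = -ε`, the
statement `HasCPV f (-a) a 0 (2∫_0^a h)` of that module), the explicit value `P∫_a^b dt/(t-x) = log[(b-x)/(x-a)]`,
the shift (2.12.8.11), and Price's nine-point rule (2.12.8.13)–(2.12.8.14) with its exactness on `𝒫_8` — none of
which those modules contain.
-/

open MeasureTheory Real Filter Topology Finset
open scoped Interval

namespace Literature.Analysis.Quadrature

/-! ## The even/odd device (2.12.8.1)–(2.12.8.6) -/

/-- The odd part `g(x) = ½[f(x) - f(-x)]` **(2.12.8.1)**. [cite: DavisRabinowitz1984, Sect. 2.12.8 (2.12.8.1)] -/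
noncomputable def cpvOddPart (f : ℝ → ℝ) (x : ℝ) : ℝ := (f x - f (-x)) / 2

/-- The even part `h(x) = ½[f(x) + f(-x)]` **(2.12.8.1)**. [cite: DavisRabinowitz1984, Sect. 2.12.8 (2.12.8.1)] -/
noncomputable def cpvEvenPart (f : ℝ → ℝ) (x : ℝ) : ℝ := (f x + f (-x)) / 2

/-- The truncated symmetric integral `∫_{-a}^{-r} f + ∫_r^a f` whose limit `r → 0+` is `P∫_{-a}^a f`.
[cite: DavisRabinowitz1984, Sect. 2.12.8 (2.12.8.5)] -/
noncomputable def cpvTrunc (f : ℝ → ℝ) (a r : ℝ) : ℝ := (∫ x in (-a)..(-r), f x) + ∫ x in r..a, f x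

/-- `f = g + h` **(2.12.8.2)**. [cite: DavisRabinowitz1984, Sect. 2.12.8 (2.12.8.2)] -/
theorem cpvOddPart_add_cpvEvenPart (f : ℝ → ℝ) (x : ℝ) : cpvOddPart f x + cpvEvenPart f x = f x := by
  simp only [cpvOddPart, cpvEvenPart]; ring

/-- `g` is odd **(2.12.8.3)**. [cite: DavisRabinowitz1984, Sect. 2.12.8 (2.12.8.3)] -/
theorem cpvOddPart_neg (f : ℝ → ℝ) (x : ℝ) : cpvOddPart f (-x) = -cpvOddPart f x := by
  simp only [cpvOddPart, neg_neg]; ring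

/-- `h` is even **(2.12.8.4)**. [cite: DavisRabinowitz1984, Sect. 2.12.8 (2.12.8.4)] -/
theorem cpvEvenPart_neg (f : ℝ → ℝ) (x : ℝ) : cpvEvenPart f (-x) = cpvEvenPart f x := by
  simp only [cpvEvenPart, neg_neg]; ring

/-- THE SPLITTING IDENTITY **(2.12.8.5)**: `∫_{-a}^{-r} f + ∫_r^a f = 2∫_r^a h` (the odd parts cancel), for `f`
interval-integrable on `[-a, -r]` and on `[r, a]`. [cite: DavisRabinowitz1984, Sect. 2.12.8 (2.12.8.5)] -/
theorem cpvTrunc_eq_two_mul_integral_evenPart {f : ℝ → ℝ} {a r : ℝ}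
    (h₁ : IntervalIntegrable f volume (-a) (-r)) (h₂ : IntervalIntegrable f volume r a) :
    cpvTrunc f a r = 2 * ∫ x in r..a, cpvEvenPart f x := by
  have hneg : IntervalIntegrable (fun x => f (-x)) volume r a := by
    simpa using (h₁.comp_sub_left 0).symm
  have e1 : (∫ x in (-a)..(-r), f x) = ∫ x in r..a, f (-x) := by
    rw [intervalIntegral.integral_comp_neg]
  unfold cpvTrunc
  rw [e1, ← intervalIntegral.integral_add hneg h₂, ← intervalIntegral.integral_const_mul]
  refine intervalIntegral.integral_congr fun x _ => ?_
  simp only [cpvEvenPart]; ring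

/-- THE DEVICE **(2.12.8.6)** as a limit theorem: if the even part `h` is interval-integrable on `[0, a]` (`0 < a`;
"it is possible that `h` has no singularity at `x = 0`") and `f` is integrable on the truncated pieces, then
`∫_{-a}^{-r} f + ∫_r^a f → 2∫_0^a h` as `r → 0+`, i.e. `P∫_{-a}^a f = 2∫_0^a h = ∫_0^a (f(x) + f(-x)) dx`.
[cite: DavisRabinowitz1984, Sect. 2.12.8 (2.12.8.6)] -/
theorem tendsto_cpvTrunc_of_evenPart_integrable {f : ℝ → ℝ} {a : ℝ} (ha : 0 < a)
    (hh : IntervalIntegrable (cpvEvenPart f) volume 0 a)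
    (hf : ∀ r ∈ Set.Ioo 0 a, IntervalIntegrable f volume (-a) (-r) ∧ IntervalIntegrable f volume r a) :
    Tendsto (cpvTrunc f a) (𝓝[>] 0) (𝓝 (2 * ∫ x in (0:ℝ)..a, cpvEvenPart f x)) := by
  -- the primitive `b ↦ ∫_a^b h` is continuous on `[[0, a]]`
  have hcont : ContinuousOn (fun b => ∫ x in a..b, cpvEvenPart f x) [[(0:ℝ), a]] :=
    intervalIntegral.continuousOn_primitive_interval' hh Set.right_mem_uIcc
  have h0 : ContinuousWithinAt (fun b => ∫ x in a..b, cpvEvenPart f x) [[(0:ℝ), a]] 0 :=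
    hcont 0 (by simp)
  have hle : 𝓝[>] (0:ℝ) ≤ 𝓝[[[(0:ℝ), a]]] 0 := by
    refine nhdsWithin_le_of_mem ?_
    have hmem : Set.Ioo (0:ℝ) a ∈ 𝓝[>] (0:ℝ) := Ioo_mem_nhdsGT ha
    filter_upwards [hmem] with r hr
    rw [Set.uIcc_of_le ha.le]
    exact ⟨hr.1.le, hr.2.le⟩
  have h1 : Tendsto (fun b => ∫ x in a..b, cpvEvenPart f x) (𝓝[>] 0) (𝓝 (∫ x in a..(0:ℝ), cpvEvenPart f x)) :=
    h0.tendsto.mono_left hle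
  have h2 : Tendsto (fun r => 2 * -(∫ x in a..r, cpvEvenPart f x)) (𝓝[>] 0)
      (𝓝 (2 * -(∫ x in a..(0:ℝ), cpvEvenPart f x))) := (h1.neg).const_mul 2
  rw [intervalIntegral.integral_symm 0 a, neg_neg] at h2
  refine h2.congr' ?_
  filter_upwards [Ioo_mem_nhdsGT ha] with r hr
  rw [cpvTrunc_eq_two_mul_integral_evenPart (hf r hr).1 (hf r hr).2, intervalIntegral.integral_symm r a,
    neg_neg]

/-- EXAMPLE 1: for `f(x) = 1/x` the even part vanishes identically, so every truncation `∫_{-a}^{-r} + ∫_r^a` is `0`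
(`0 < r ≤ a`) and `P∫_{-1}^1 dx/x = 0`. [cite: DavisRabinowitz1984, Sect. 2.12.8 (2.12.8.6)] -/
theorem cpvEvenPart_inv (x : ℝ) : cpvEvenPart (fun t => 1 / t) x = 0 := by
  simp only [cpvEvenPart]; ring

/-- EXAMPLE 1 (continued): `∫_{-a}^{-r} dx/x + ∫_r^a dx/x = 0` for `0 < r ≤ a`.
[cite: DavisRabinowitz1984, Sect. 2.12.8 (2.12.8.6)] -/
theorem cpvTrunc_inv {a r : ℝ} (hr : 0 < r) (hra : r ≤ a) : cpvTrunc (fun t => 1 / t) a r = 0 := by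
  have h0 : (0:ℝ) ∉ [[r, a]] := by
    rw [Set.uIcc_of_le hra]; intro h; exact absurd h.1 (not_le.mpr hr)
  have h0' : (0:ℝ) ∉ [[-a, -r]] := by
    rw [Set.uIcc_of_le (neg_le_neg hra)]; intro h; linarith [h.2]
  have h₂ : IntervalIntegrable (fun t : ℝ => 1 / t) volume r a := intervalIntegral.intervalIntegrable_one_div
    (fun x hx => by rintro rfl; exact h0 hx) continuousOn_id
  have h₁ : IntervalIntegrable (fun t : ℝ => 1 / t) volume (-a) (-r) := intervalIntegral.intervalIntegrable_one_div
    (fun x hx => by rintro rfl; exact h0' hx) continuousOn_id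
  rw [cpvTrunc_eq_two_mul_integral_evenPart h₁ h₂]
  simp only [cpvEvenPart_inv, intervalIntegral.integral_zero, mul_zero]

/-- EXAMPLE 2: for `f(x) = eˣ/x` the even part is `h(x) = sinh x / x` (an apparent singularity only), so
`P∫_{-1}^1 eˣ/x dx = 2∫_0^1 sinh x/x dx`. [cite: DavisRabinowitz1984, Sect. 2.12.8 (2.12.8.6)] -/
theorem cpvEvenPart_exp_div (x : ℝ) : cpvEvenPart (fun t => exp t / t) x = sinh x / x := by
  rcases eq_or_ne x 0 with rfl | hx
  · simp [cpvEvenPart]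
  · simp only [cpvEvenPart, Real.sinh_eq]
    field_simp
    ring

/-! ## Subtracting the singularity for the Hilbert transform (2.12.8.8)–(2.12.8.11) -/

/-- The difference quotient `φ(t, x) = [f(t) - f(x)]/(t - x)` **(2.12.8.10)**.
[cite: DavisRabinowitz1984, Sect. 2.12.8 (2.12.8.10)] -/
noncomputable def cpvPhi (f : ℝ → ℝ) (t x : ℝ) : ℝ := (f t - f x) / (t - x)

/-- The pointwise subtraction behind (2.12.8.9): `f(t)/(t-x) = φ(t,x) + f(x)/(t-x)` for `t ≠ x`.
[cite: DavisRabinowitz1984, Sect. 2.12.8 (2.12.8.9)] -/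
theorem div_sub_eq_cpvPhi_add {f : ℝ → ℝ} {t x : ℝ} (htx : t ≠ x) :
    f t / (t - x) = cpvPhi f t x + f x / (t - x) := by
  have : t - x ≠ 0 := sub_ne_zero.mpr htx
  simp only [cpvPhi]
  field_simp
  ring

/-- THE PRINCIPAL VALUE `P∫_a^b dt/(t-x) = log[(b-x)/(x-a)]` of (2.12.8.9), in the strong form: for every
`0 < r` with `r < x - a`, `r < b - x` the truncation is ALREADY equal to `log[(b-x)/(x-a)]` (independent of `r`).
[cite: DavisRabinowitz1984, Sect. 2.12.8 (2.12.8.9)] -/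
theorem cpv_integral_one_div_sub {a b x r : ℝ} (hr : 0 < r) (hra : r < x - a) (hrb : r < b - x) :
    (∫ t in a..(x - r), 1 / (t - x)) + ∫ t in (x + r)..b, 1 / (t - x) = log ((b - x) / (x - a)) := by
  have hxa : 0 < x - a := by linarith
  have hbx : 0 < b - x := by linarith
  have e1 : (∫ t in a..(x - r), 1 / (t - x)) = log (r / (x - a)) := by
    rw [intervalIntegral.integral_comp_sub_right (fun u => 1 / u) x, integral_one_div]
    · congr 1
      rw [show x - r - x = -r by ring, show a - x = -(x - a) by ring, neg_div_neg_eq]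
    · rw [Set.uIcc_of_le (by linarith)]
      intro h; linarith [h.2]
  have e2 : (∫ t in (x + r)..b, 1 / (t - x)) = log ((b - x) / r) := by
    rw [intervalIntegral.integral_comp_sub_right (fun u => 1 / u) x, integral_one_div]
    · congr 1
      rw [show x + r - x = r by ring]
    · rw [Set.uIcc_of_le (by linarith)]
      intro h; linarith [h.1]
  rw [e1, e2, ← Real.log_mul (div_pos hr hxa).ne' (div_pos hbx hr).ne']
  congr 1
  have hr0 : r ≠ 0 := hr.ne'
  have hxa0 : x - a ≠ 0 := hxa.ne'
  field_simp

/-- The shift **(2.12.8.11)**: `∫_{x-h}^{x+h} φ(t, x) dt = ∫_{-h}^{h} [f(t+x) - f(x)]/t dt`.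
[cite: DavisRabinowitz1984, Sect. 2.12.8 (2.12.8.11)] -/
theorem integral_cpvPhi_shift (f : ℝ → ℝ) (x h : ℝ) :
    (∫ t in (x - h)..(x + h), cpvPhi f t x) = ∫ t in (-h)..h, (f (t + x) - f x) / t := by
  have := intervalIntegral.integral_comp_add_right (fun t => (f t - f x) / (t - x)) x (a := -h) (b := h)
  simp only [add_sub_cancel_right] at this
  rw [show -h + x = x - h by ring, show h + x = x + h by ring] at this
  simpa only [cpvPhi] using this.symm

/-! ## Price's nine-point rule (2.12.8.13)–(2.12.8.14) -/

/-- Price's nine-point rule for `P∫_{-1}^1 f(x)/x dx` **(2.12.8.13)** with the exact coefficients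
`A = 2459/33075`, `B = 1856/3675`, `C = 592/4725`, `D = 9152/4725` **(2.12.8.14)** (the coefficient of `f(0)` is `0`).
[cite: DavisRabinowitz1984, Sect. 2.12.8 (2.12.8.13)-(2.12.8.14)] -/
noncomputable def priceNinePoint (f : ℝ → ℝ) : ℝ :=
  2459 / 33075 * (f 1 - f (-1)) + 1856 / 3675 * (f (3 / 4) - f (-3 / 4)) + 592 / 4725 * (f (1 / 2) - f (-1 / 2)) +
    9152 / 4725 * (f (1 / 4) - f (-1 / 4))

/-- The decimal values printed in (2.12.8.14): `A ≈ .07434618292`, `B ≈ .5050340136`, `C ≈ .1252910052`,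
`D ≈ 1.936931217` (each to within `10⁻⁹`). [cite: DavisRabinowitz1984, Sect. 2.12.8 (2.12.8.14)] -/
theorem priceNinePoint_coeff_decimals :
    |(2459 / 33075 : ℝ) - 0.07434618292| < 1e-9 ∧ |(1856 / 3675 : ℝ) - 0.5050340136| < 1e-9 ∧
      |(592 / 4725 : ℝ) - 0.1252910052| < 1e-9 ∧ |(9152 / 4725 : ℝ) - 1.936931217| < 1e-9 := by
  refine ⟨?_, ?_, ?_, ?_⟩ <;> rw [abs_lt] <;> constructor <;> norm_num

/-- EXACTNESS of Price's rule for `f ∈ 𝒫_8` **(2.12.8.13)**, on the monomial basis: for `f(x) = x^j`, `1 ≤ j ≤ 8`,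
the principal value is the ordinary integral `∫_{-1}^1 x^{j-1} dx` (`= 0` for even `j`, `2/j` for odd `j`) and the
rule reproduces it; for `j = 0` both sides are `0` (Example 1). [cite: DavisRabinowitz1984, Sect. 2.12.8 (2.12.8.13)] -/
theorem priceNinePoint_exact_monomial (j : ℕ) (hj1 : 1 ≤ j) (hj : j ≤ 8) :
    priceNinePoint (fun x => x ^ j) = ∫ x in (-1:ℝ)..1, x ^ (j - 1) := by
  rw [integral_pow]
  interval_cases j <;> simp only [priceNinePoint] <;> norm_num

/-- … and for `j = 0` (constant `f`): the rule gives `0`, which is `P∫_{-1}^1 dx/x` (Example 1, `cpvTrunc_inv`).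
[cite: DavisRabinowitz1984, Sect. 2.12.8 (2.12.8.13)] -/
theorem priceNinePoint_const (c : ℝ) : priceNinePoint (fun _ => c) = 0 := by
  simp [priceNinePoint]

/-- The rule annihilates even functions and doubles on odd ones: `priceNinePoint f = 2(A f(1) + B f(¾) + C f(½) +
D f(¼))` for odd `f` — the structure behind (2.12.8.17). [cite: DavisRabinowitz1984, Sect. 2.12.8 (2.12.8.17)] -/
theorem priceNinePoint_of_odd {f : ℝ → ℝ} (hf : ∀ x, f (-x) = -f x) :
    priceNinePoint f =
      2 * (2459 / 33075 * f 1 + 1856 / 3675 * f (3 / 4) + 592 / 4725 * f (1 / 2) + 9152 / 4725 * f (1 / 4)) := by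
  simp only [priceNinePoint]
  rw [hf 1, show (-3 / 4 : ℝ) = -(3 / 4) by norm_num, hf, show (-1 / 2 : ℝ) = -(1 / 2) by norm_num, hf,
    show (-1 / 4 : ℝ) = -(1 / 4) by norm_num, hf]
  ring

/-- **(2.12.8.17)**: by the device (2.12.8.6) applied to `f(x)/x`, whose even part is `[f(x) - f(-x)]/(2x)`:
`2 h(x) = [f(x) - f(-x)]/x`. [cite: DavisRabinowitz1984, Sect. 2.12.8 (2.12.8.17)] -/
theorem two_mul_cpvEvenPart_div (f : ℝ → ℝ) (x : ℝ) :
    2 * cpvEvenPart (fun t => f t / t) x = (f x - f (-x)) / x := by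
  simp only [cpvEvenPart]
  rw [neg_eq_neg_one_mul x, ← div_div]
  ring_nf

end Literature.Analysis.Quadrature
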